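import Summits.AtomisticToContinuum.Crystallization.Theorems.FrustratedLawDichotomyStrainedPatchHomLeafTableRow

/-!
# v3 ("K") ROW CERTIFICATION for the table-driven leaf checker: per-row FREE curvature ranges, certified PIECEWISE with computed root brackets

decomp-a2c hand-1 g22 (crux `AperiodicFrustratedLawGap`, stmt-AtomisticToContinuum-27623; critic rows 863/865 "checker v3 = `Row.kW`").  The v2 window-mode
certification `Row.okWin` brackets a row's curvature range `[A, B]` by the FIXED roots `s ∓ 2^42` (`U42`), which caps the usable label range at
`≈ 0.13` in `q` and hence the leaf size at entry half-width `2⁻¹²` (hand-1 g21 Pilot D).  Here the SAME `Row` format is certified differently: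

* `Row.okK E P r` — value / derivative exactly as before (generic reflected checks when `r.s = 0`, window point enclosures at the exact root `r.s`
  otherwise), but the curvature constant `M` is certified on `[A, B]` by splitting the range into at most `P + 1` consecutive pieces (`curvTail`), each
  piece checked by the generic reflected check `curvOK` when it ends below `16`, and otherwise by the window enclosure `eWin` evaluated at the COMPUTED
  roots `rootFloor (a·SC)`, `rootCeil (b·SC)` (bisection; the bracketing inequalities are RE-CHECKED, so the root routine needs no correctness lemma).
  Any range width is allowed; the piecewise maximum is a much tighter constant than one termwise bound over the whole range.
* `QT.allOKK E P` — every row passes `Row.okK E P`.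
* `Row.okK_sound` — the conclusion of `Row.ok_sound` verbatim; `QT.findLE_okK` / `QT.findLE_none_okK`.  The leaf-check soundness is re-assembled
  against `tab.allOK E ∨ tab.allOKK E P` in the companion module `…HomLeafTableSoundK`.

All definitions computable (`Nat.*` primitives, `match` on `Bool`); 0 sorry; standard axioms.  `--supports stmt-AtomisticToContinuum-27623`.
-/

namespace Summit.AtomisticToContinuum.Crystallization.Theorems.FrustratedLawDichotomyStrainedPatchHomLeafTableCheck

open Set
open Literature.Analysis.ValidatedNumerics.Numerics
open Summit.AtomisticToContinuum.Crystallization.Theorems.FrustratedLawDichotomySchurCut (effPot w₄₅ ω₄)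
open Summit.AtomisticToContinuum.Crystallization.Theorems.FrustratedLawDichotomyStrainedPatchHomTermCalculus (monotoneOn_Icc_of_pieces)
open Summit.AtomisticToContinuum.Crystallization.Theorems.FrustratedLawDichotomyStrainedPatchHomTermCalculusSq (monotoneOn_dphi45_window
  monotoneOn_dphi45_far)
open Summit.AtomisticToContinuum.Crystallization.Theorems.FrustratedLawDichotomyStrainedPatchHomTermPointBounds (phi45_window_ge
  dphi45_window_ge dphi45_window_le)
open Summit.AtomisticToContinuum.Crystallization.Theorems.FrustratedLawDichotomyStrainedPatchHomTermEval (curvOK curvOK_sound eWin mem_eWin)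
open Summit.AtomisticToContinuum.Crystallization.Theorems.FrustratedLawDichotomyStrainedPatchHomTermEvalPoint
  (valLoOK derivOK valLoOK_sound derivOK_sound eWinVal eWinDer mem_eWinVal mem_eWinDer)

/-! ## §1. Computed square-root brackets (results are re-checked; no correctness lemma needed) -/

/-- Bisection step for `⌊√n⌋`: invariant `lo² ≤ n < hi²`, `fuel` halvings. -/
def rootIter (n : ℕ) : ℕ → ℕ → ℕ → ℕ
  | 0, a, _ => a
  | fuel + 1, a, b =>
    match Nat.ble (Nat.mul (Nat.div (Nat.add a b) 2) (Nat.div (Nat.add a b) 2)) n with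
    | true => (match Nat.ble b (Nat.add a 1) with
      | true => a
      | false => rootIter n fuel (Nat.div (Nat.add a b) 2) b)
    | false => rootIter n fuel a (Nat.div (Nat.add a b) 2)

/-- `⌊√n⌋` for `n < 2^104` (52 halvings from `[0, 2^52]`). -/
def rootFloor (n : ℕ) : ℕ := rootIter n 53 0 4503599627370496

/-- `⌈√n⌉` for `n < 2^104`. -/
def rootCeil (n : ℕ) : ℕ :=
  match Nat.beq (Nat.mul (rootFloor n) (rootFloor n)) n with
  | true => rootFloor n
  | false => Nat.add (rootFloor n) 1

/-! ## §2. Piecewise curvature certification -/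

/-- `16·SC`: pieces ending at or below it are certified by the generic reflected check `curvOK`; above it by the exact-root window enclosure. -/
def W16 : ℕ := Nat.mul 16 SCN

/-- Window certification of the constant `M` on the piece `[a, b]` (`9·SC ≤ a ≤ b`) from root brackets `lo ≤ √(a·SC)`, `√(b·SC) ≤ hi` (re-checked):
`eWin lo hi ≤ M` if `b ≤ 81/4·SC`, else `eWin lo (9·SC/2) ≤ M` (glued with the far regime, where any `M ≥ 0` works). -/
def pieceWinOK (a b M lo hi : ℕ) : Bool :=
  Nat.ble (Nat.mul 9 SCN) a && Nat.ble a b && Nat.blt 0 lo && Nat.ble (Nat.mul lo lo) (Nat.mul a SCN) &&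
    (match Nat.ble (Nat.mul 4 b) (Nat.mul 81 SCN) with
      | true => Nat.ble (Nat.mul b SCN) (Nat.mul hi hi) && decide ((eWin (lo : ℤ) (hi : ℤ)).hi ≤ (M : ℤ))
      | false => decide ((eWin (lo : ℤ) (9 * (SC : ℤ) / 2)).hi ≤ (M : ℤ)))

/-- Certification of `M` on ONE piece `[a, b]`: generic reflected check below `16`, computed-root window check above. -/
def pieceOK (a b M : ℕ) : Bool :=
  match Nat.ble b W16 with
  | true => curvOK (a : ℤ) (b : ℤ) (M : ℤ)
  | false => pieceWinOK a b M (rootFloor (Nat.mul a SCN)) (rootCeil (Nat.mul b SCN))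

/-- Certification of `M` on `[a, B]` by consecutive pieces of width `step` (at most `fuel + 1` pieces; the last one ends at `B`). -/
def curvTail (M B step : ℕ) : ℕ → ℕ → Bool
  | 0, a => pieceOK a B M
  | fuel + 1, a =>
    match Nat.blt (Nat.add a step) B with
    | true => pieceOK a (Nat.add a step) M && curvTail M B step fuel (Nat.add a step)
    | false => pieceOK a B M

/-! ## §3. Row and table certification, v3 -/

/-- Value and derivative checks of a row: generic reflected checks (`s = 0`) or the window point enclosures at the exact root `s` (`s·s = t·SC`,
`9 ≤ t/SC ≤ 81/4`). -/
def Row.vdOK (E : ℕ) (r : Row) : Bool :=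
  match Nat.beq r.s 0 with
  | true => valLoOK (r.t : ℤ) (sgnZ r.sV r.aV) && derivOK (r.t : ℤ) (sgnZ r.sD r.aD - (E : ℤ)) (sgnZ r.sD r.aD + (E : ℤ))
  | false => Nat.beq (Nat.mul r.s r.s) (Nat.mul r.t SCN) && Nat.ble (Nat.mul 9 SCN) r.t && Nat.ble (Nat.mul 4 r.t) (Nat.mul 81 SCN) &&
      decide (sgnZ r.sV r.aV ≤ (eWinVal (FI.ofScaled (r.t : ℤ)) (r.s : ℤ)).lo) &&
      decide (sgnZ r.sD r.aD - (E : ℤ) ≤ (eWinDer (r.s : ℤ) (r.s : ℤ)).lo) && decide ((eWinDer (r.s : ℤ) (r.s : ℤ)).hi ≤ sgnZ r.sD r.aD + (E : ℤ))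

/-- ★ **v3 ROW CERTIFICATION**: value / derivative (`vdOK`), `0 < A ≤ t ≤ B`, and the curvature constant certified piecewise on `[A, B]` with
`P + 1` pieces of width `(B − A)/(P + 1)` (the last piece absorbs the rounding). -/
def Row.okK (E P : ℕ) (r : Row) : Bool :=
  r.vdOK E && Nat.blt 0 r.A && Nat.ble r.A r.t && Nat.ble r.t r.B && curvTail r.M r.B (Nat.div (Nat.sub r.B r.A) (Nat.add P 1)) P r.A

/-- Every row of the table passes `Row.okK E P`. -/
def QT.allOKK (E P : ℕ) : QT → Bool
  | .nil => true
  | .node l r rt => QT.allOKK E P l && r.okK E P && QT.allOKK E P rt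

/-! ## §4. Soundness of the v3 certification -/

/-- One window piece is sound: `φ′ + (M/SC)·id` monotone on `[a/SC, b/SC]`, `a ≤ b`. [folklore] -/
theorem pieceWinOK_sound {a b M lo hi : ℕ} (h : pieceWinOK a b M lo hi = true) :
    MonotoneOn (fun t => deriv (effPot w₄₅ ω₄ (3 / 400)) (Real.sqrt t) / (2 * Real.sqrt t) + ((M : ℤ) : ℝ) / SC * t)
      (Icc (((a : ℤ) : ℝ) / SC) (((b : ℤ) : ℝ) / SC)) ∧ a ≤ b := by
  unfold pieceWinOK at h
  simp only [Bool.and_eq_true, Nat.ble_eq, Nat.blt_eq, Nat.mul_eq] at h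
  obtain ⟨⟨⟨⟨h9a, hab⟩, hlo⟩, hloa⟩, hcurv⟩ := h
  have hS := SC_pos
  have hA9 : (9 : ℝ) ≤ ((a : ℤ) : ℝ) / SC := by
    have h' : 9 * SCN ≤ 1 * a := by omega
    have := le_div_of_nat (m := 9) (n := 1) (by norm_num) h'
    norm_num at this
    exact this
  have hM0 : 0 ≤ ((M : ℤ) : ℝ) / SC := div_nonneg (by exact_mod_cast Nat.zero_le _) hS.le
  have hloZ : (0 : ℤ) < (lo : ℤ) := by exact_mod_cast hlo
  have hloR : (0 : ℝ) < ((lo : ℤ) : ℝ) / SC := div_pos (by exact_mod_cast hlo) hS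
  have hlosq : (((lo : ℤ) : ℝ) / SC) ^ 2 ≤ ((a : ℤ) : ℝ) / SC := sq_div_le_of_nat hloa
  have habR : ((a : ℤ) : ℝ) / SC ≤ ((b : ℤ) : ℝ) / SC := div_le_div_of_nonneg_right (by exact_mod_cast hab) hS.le
  refine ⟨?_, hab⟩
  revert hcurv
  cases hcase : Nat.ble (4 * b) (81 * SCN) <;> intro hcurv
  · -- b beyond 81/4: window on [a, 81/4] glued with far on [81/4, b]
    simp only [decide_eq_true_eq] at hcurv
    have hB81 : (81 : ℝ) / 4 ≤ ((b : ℤ) : ℝ) / SC := by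
      have h' : ¬ (4 * b ≤ 81 * SCN) := fun hle => by
        have := Nat.ble_eq_true_of_le hle
        rw [this] at hcase
        exact Bool.noConfusion hcase
      exact le_div_of_nat (by norm_num) (le_of_lt (not_le.1 h'))
    have h92 : (0 : ℤ) < 9 * (SC : ℤ) / 2 := by rw [← SCN_eq]; decide
    have hmem := mem_eWin hloZ h92
    have e92 : (((9 * (SC : ℤ) / 2 : ℤ)) : ℝ) / SC = 9 / 2 := by
      rw [← SCN_eq]; push_cast [SCN]; norm_num [SCN]
    rw [e92] at hmem
    have hle := (FI.le_hi_div hmem).trans (div_le_div_of_nonneg_right (show ((eWin _ _).hi : ℝ) ≤ (M : ℤ) by exact_mod_cast hcurv) hS.le)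
    by_cases ha81 : ((a : ℤ) : ℝ) / SC ≤ 81 / 4
    · have hw := monotoneOn_dphi45_window hA9 le_rfl hloR hlosq (show (81:ℝ)/4 ≤ (9/2) ^ 2 by norm_num) (by norm_num) hle
      exact monotoneOn_Icc_of_pieces ha81 hB81 hw (monotoneOn_dphi45_far le_rfl hM0)
    · exact monotoneOn_dphi45_far (le_of_lt (not_le.1 ha81)) hM0
  · -- b ≤ 81/4: window on [a, b] with the computed roots
    simp only [Bool.and_eq_true, Nat.ble_eq, decide_eq_true_eq] at hcurv
    obtain ⟨hbhi, hM⟩ := hcurv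
    have hB81 : ((b : ℤ) : ℝ) / SC ≤ 81 / 4 := div_le_of_nat (by norm_num) (by simpa [Nat.ble_eq] using hcase)
    have hhi : 0 < hi := by
      rcases Nat.eq_zero_or_pos hi with h0 | h0
      · exfalso
        rw [h0, Nat.mul_zero] at hbhi
        have hpos : 0 < SCN := by simp [SCN]
        rcases Nat.mul_eq_zero.mp (Nat.le_zero.mp hbhi) with hb | hS0
        · omega
        · omega
      · exact h0
    have hhiZ : (0 : ℤ) < (hi : ℤ) := by exact_mod_cast hhi
    have hhiR : (0 : ℝ) ≤ ((hi : ℤ) : ℝ) / SC := div_nonneg (by exact_mod_cast Nat.zero_le _) hS.le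
    have hhisq : ((b : ℤ) : ℝ) / SC ≤ (((hi : ℤ) : ℝ) / SC) ^ 2 := div_le_sq_of_nat hbhi
    have hmem := mem_eWin hloZ hhiZ
    have hle := (FI.le_hi_div hmem).trans (div_le_div_of_nonneg_right (show ((eWin _ _).hi : ℝ) ≤ (M : ℤ) by exact_mod_cast hM) hS.le)
    exact monotoneOn_dphi45_window hA9 hB81 hloR hlosq hhisq hhiR hle

/-- One piece is sound: `0 ≤ M/SC`-free form — `φ′ + (M/SC)·id` monotone on `[a/SC, b/SC]` and `a ≤ b`. [folklore] -/
theorem pieceOK_sound {a b M : ℕ} (h : pieceOK a b M = true) :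
    MonotoneOn (fun t => deriv (effPot w₄₅ ω₄ (3 / 400)) (Real.sqrt t) / (2 * Real.sqrt t) + ((M : ℤ) : ℝ) / SC * t)
      (Icc (((a : ℤ) : ℝ) / SC) (((b : ℤ) : ℝ) / SC)) ∧ a ≤ b := by
  unfold pieceOK at h
  split at h
  · have hc := curvOK_sound h
    have hab : a ≤ b := by
      have h' := h
      unfold curvOK at h'
      simp only [Bool.and_eq_true, decide_eq_true_eq] at h'
      exact_mod_cast h'.1.2
    refine ⟨?_, hab⟩
    have e1 : (((a : ℤ) : ℝ)) = ((a : ℤ) : ℝ) := rfl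
    simpa only [Int.cast_natCast] using hc.2
  · exact pieceWinOK_sound h

/-- The piecewise certification is sound: `φ′ + (M/SC)·id` monotone on `[a/SC, B/SC]` whenever `a ≤ B`. [folklore] -/
theorem curvTail_sound {M B step : ℕ} : ∀ (fuel a : ℕ), curvTail M B step fuel a = true → a ≤ B →
    MonotoneOn (fun t => deriv (effPot w₄₅ ω₄ (3 / 400)) (Real.sqrt t) / (2 * Real.sqrt t) + ((M : ℤ) : ℝ) / SC * t)
      (Icc (((a : ℤ) : ℝ) / SC) (((B : ℤ) : ℝ) / SC))
  | 0, a, h, _ => by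
    unfold curvTail at h
    exact (pieceOK_sound h).1
  | fuel + 1, a, h, haB => by
    unfold curvTail at h
    split at h
    · rename_i hlt
      simp only [Bool.and_eq_true] at h
      obtain ⟨h1, h2⟩ := h
      have hlt' : a + step < B := by simpa [Nat.blt_eq] using hlt
      have hp := pieceOK_sound h1
      have ht := curvTail_sound fuel (a + step) h2 hlt'.le
      have hS := SC_pos
      refine monotoneOn_Icc_of_pieces ?_ ?_ hp.1 ?_
      · exact div_le_div_of_nonneg_right (by exact_mod_cast hp.2) hS.le
      · exact div_le_div_of_nonneg_right (by exact_mod_cast hlt'.le) hS.le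
      · simpa only [Nat.add_eq, Nat.cast_add] using ht
    · exact (pieceOK_sound h).1

/-- Value and derivative checks are sound. [folklore] -/
theorem Row.vdOK_sound {E : ℕ} {r : Row} (h : r.vdOK E = true) :
    ((sgnZ r.sV r.aV : ℤ) : ℝ) / SC ≤ effPot w₄₅ ω₄ (3 / 400) (Real.sqrt (((r.t : ℤ) : ℝ) / SC)) ∧
    deriv (effPot w₄₅ ω₄ (3 / 400)) (Real.sqrt (((r.t : ℤ) : ℝ) / SC)) / (2 * Real.sqrt (((r.t : ℤ) : ℝ) / SC)) ∈
      Icc (((sgnZ r.sD r.aD - (E : ℤ) : ℤ) : ℝ) / SC) (((sgnZ r.sD r.aD + (E : ℤ) : ℤ) : ℝ) / SC) := by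
  unfold Row.vdOK at h
  split at h
  · simp only [Bool.and_eq_true] at h
    exact ⟨valLoOK_sound h.1, derivOK_sound h.2⟩
  · simp only [Bool.and_eq_true, Nat.ble_eq, Nat.beq_eq, decide_eq_true_eq, Nat.mul_eq] at h
    obtain ⟨⟨⟨⟨⟨hss, ht9⟩, ht81⟩, hV⟩, hDlo⟩, hDhi⟩ := h
    have hS := SC_pos
    have ht9R : (9 : ℝ) ≤ ((r.t : ℤ) : ℝ) / SC := by
      have h' : 9 * SCN ≤ 1 * r.t := by omega
      have := le_div_of_nat (m := 9) (n := 1) (by norm_num) h'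
      norm_num at this
      exact this
    have ht81R : ((r.t : ℤ) : ℝ) / SC ≤ 81 / 4 := div_le_of_nat (by norm_num) ht81
    have htpos : (0 : ℝ) < ((r.t : ℤ) : ℝ) / SC := by linarith
    have hs_pos : 0 < r.s := by
      rcases Nat.eq_zero_or_pos r.s with h0 | h0
      · exfalso
        rw [h0, Nat.mul_zero] at hss
        have hpos : 0 < SCN := by simp [SCN]
        rcases Nat.mul_eq_zero.mp hss.symm with hb | hS0
        · omega
        · omega
      · exact h0
    have hsZ : (0 : ℤ) < (r.s : ℤ) := by exact_mod_cast hs_pos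
    have htZ : 0 < (FI.ofScaled (r.t : ℤ)).lo := by
      have h' : (0:ℝ) < ((r.t : ℤ) : ℝ) := by have := mul_pos htpos hS; rwa [div_mul_cancel₀ _ hS.ne'] at this
      have h'' : (0 : ℤ) < (r.t : ℤ) := by exact_mod_cast h'
      exact h''
    have hroot : (((r.s : ℤ) : ℝ) / SC) ^ 2 = ((r.t : ℤ) : ℝ) / SC := by
      have e : (r.s : ℝ) * r.s = r.t * SC := by rw [SCN_eq] at hss; exact_mod_cast hss
      simp only [Int.cast_natCast]
      rw [div_pow, div_eq_div_iff (pow_pos hS 2).ne' hS.ne']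
      calc (r.s : ℝ) ^ 2 * SC = (r.s * r.s) * SC := by ring
        _ = r.t * SC * SC := by rw [e]
        _ = r.t * (SC : ℝ) ^ 2 := by ring
    have hs0 : (0 : ℝ) < ((r.s : ℤ) : ℝ) / SC := div_pos (by exact_mod_cast hs_pos) hS
    have hq := FI.mem_ofScaled (r.t : ℤ)
    refine ⟨?_, ?_⟩
    · have hmain := phi45_window_ge ht9R ht81R hs0.le hroot.symm.le
      exact le_trans (le_trans (div_le_div_of_nonneg_right (by exact_mod_cast hV) hS.le) (FI.lo_div_le (mem_eWinVal hq htZ))) hmain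
    · have hlow := dphi45_window_ge ht9R ht81R hs0 hroot.le hs0.le hroot.symm.le
      have hupp := dphi45_window_le ht9R ht81R hs0 hroot.le hs0.le hroot.symm.le
      have mL := FI.lo_div_le (mem_eWinDer hsZ hsZ)
      have mU := FI.le_hi_div (mem_eWinDer hsZ hsZ)
      exact ⟨le_trans (div_le_div_of_nonneg_right (by exact_mod_cast hDlo) hS.le) (mL.trans hlow),
        le_trans (hupp.trans mU) (div_le_div_of_nonneg_right (by exact_mod_cast hDhi) hS.le)⟩

/-- ★★ **v3 ROW CERTIFICATION IS SOUND** — the conclusion of `Row.ok_sound` verbatim: in real terms (`φ = W₄₅ ∘ √`, data divided by `SC`) the value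
bound at the grid point, the derivative enclosure of half-width `E`, `0 ≤ M/SC` with `φ′ + (M/SC)·id` monotone on `[A/SC, B/SC]`, and `0 < A ≤ t ≤ B`.
[folklore] -/
theorem Row.okK_sound {E P : ℕ} {r : Row} (h : r.okK E P = true) :
    ((sgnZ r.sV r.aV : ℤ) : ℝ) / SC ≤ effPot w₄₅ ω₄ (3 / 400) (Real.sqrt (((r.t : ℤ) : ℝ) / SC)) ∧
    deriv (effPot w₄₅ ω₄ (3 / 400)) (Real.sqrt (((r.t : ℤ) : ℝ) / SC)) / (2 * Real.sqrt (((r.t : ℤ) : ℝ) / SC)) ∈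
      Icc (((sgnZ r.sD r.aD - (E : ℤ) : ℤ) : ℝ) / SC) (((sgnZ r.sD r.aD + (E : ℤ) : ℤ) : ℝ) / SC) ∧
    0 ≤ ((r.M : ℤ) : ℝ) / SC ∧
    MonotoneOn (fun t => deriv (effPot w₄₅ ω₄ (3 / 400)) (Real.sqrt t) / (2 * Real.sqrt t) + ((r.M : ℤ) : ℝ) / SC * t)
      (Icc (((r.A : ℤ) : ℝ) / SC) (((r.B : ℤ) : ℝ) / SC)) ∧
    0 < r.A ∧ r.A ≤ r.t ∧ r.t ≤ r.B := by
  unfold Row.okK at h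
  simp only [Bool.and_eq_true, Nat.ble_eq, Nat.blt_eq] at h
  obtain ⟨⟨⟨⟨hvd, hA0⟩, hAt⟩, htB⟩, hcurv⟩ := h
  have hvd' := Row.vdOK_sound hvd
  have hmono := curvTail_sound (M := r.M) (B := r.B) _ _ hcurv (hAt.trans htB)
  exact ⟨hvd'.1, hvd'.2, div_nonneg (by exact_mod_cast Nat.zero_le _) SC_pos.le, hmono, hA0, hAt, htB⟩

/-- Any row returned by `findLE` from a v3-certified table (and a certified or empty `best`) is certified. [formal bookkeeping] -/
theorem QT.findLE_okK {E P : ℕ} (q : ℕ) :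
    ∀ (tab : QT) (best : Option Row), tab.allOKK E P = true → (∀ r, best = some r → r.okK E P = true) →
      ∀ r, tab.findLE q best = some r → r.okK E P = true
  | .nil, best, _, hbest, r, hr => hbest r hr
  | .node l row rt, best, htab, hbest, r, hr => by
    simp only [QT.allOKK, Bool.and_eq_true] at htab
    obtain ⟨⟨hl, hrow⟩, hrt⟩ := htab
    unfold QT.findLE at hr
    split at hr
    · exact QT.findLE_okK q l best hl hbest r hr
    · exact QT.findLE_okK q rt (some row) hrt (fun r' hr' => by cases hr'; exact hrow) r hr

/-- The row found for a label from a v3-certified table, searched from `none`, is certified. [formal bookkeeping] -/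
theorem QT.findLE_none_okK {E P : ℕ} {q : ℕ} {tab : QT} (htab : tab.allOKK E P = true) {r : Row} (hr : tab.findLE q none = some r) :
    r.okK E P = true :=
  QT.findLE_okK q tab none htab (fun _ h => by cases h) r hr

end Summit.AtomisticToContinuum.Crystallization.Theorems.FrustratedLawDichotomyStrainedPatchHomLeafTableCheck
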